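import Summits.QuantumFields.YangMills.Theorems.BalabanUVNodesK1V10Defs

/-!
# BalabanUVNodes ∕ K1⁹ — THE W-END ROAD: the body of `StabilityBRunRowsAtRecordR13SepCoPHV` at a world bound to the REVISED record datum from WINDOW-GUARDED nodes and the run
# letters («LINE 2′» of the registered K1 «v10» skeleton), and K1⁹ BY NAME from the three registered LINE-2′ stub texts (`K1V10Defs`)

(Track A; DAG node N24 = [B2] composite — cluster K1, crux K1⁹ `StabilityBRunRowsAtRecordR13SepCoPHV` = stmt-QuantumFields-27364 (DECIDING; skeleton of record «v10» sha256
4b84746c2d4b6041…, LINE 1 ∪ LINE 2′); seat `pub-ymgap-dag-n24-c` g12; 2026-08-28; count-neutral helper `--supports stmt-QuantumFields-27364`.  First refusal given on the pub-ymgap bus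
to dag-n13-w3 (author of the LINE-2 = V-END road `…K1R9BodyAtRevisedRecordWorldOfNodesRunLetters`, p627483, which this file imports through `K1V10Defs`) and to ym-nodeO DEF-1 (author of
`K1V10Defs` p634834, who released the by-name composition to this file, bus l.38451).)

WHY.  The DAG's END reads the thirteen paper nodes of a leaf world ONLY on runs inside the world's coupling window: `Dag.UVStability4D ℓ := ℓ.smallCouplings → …`
(`DagBinding.uvStability_of_nodes`, `endStatementBPrinted_of_worldsP`).  LINE 2's rung 1ⱽ (`K1V9Defs.NodesAtSomeRecord13PWSV`) nevertheless asks `∀ P, Nodes (leavesP w P)` — on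
off-window runs too, where the [IV] pin is only junk-servable (this seat's LOCATED-RUNG1-PIN, bus l.36525; director-ym №216; plan g86's R1W sheet).  The registered «v10» LINE 2′ therefore
guards both the nodes and the pin by `(leavesP w P).smallCouplings →` (`K1V10Defs.NodesAtSomeRecord13PWSVW` ∕ `…RunRowsAtSomeRecord13PWSVW` ∕ `…RunRowsContAtSomeRecord13PWSVW`,
the three registered stub texts verbatim), and its composition needs the END + WINDOW AT THE REVISED DATUM FROM THE GUARDED NODES — the skeleton's kernel glue
`endStatementBPrinted_window_of_recordSV_of_nodesW_of_runLetters` (v10 :540–:706, kernel-checked there).  THIS FILE puts that glue into the tree (general `N` where the V-END road is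
general) and closes LINE 2′'s by-name chain: three by-name proofs of the registered VW stub texts give the route decl through §3.

CONTENTS (0 `sorry`, 0 `def`, no `instance`, no `notation`; kernel bookkeeping over landed theorems — nothing of Bałaban asserted):
* §1 `endStatementBPrinted_of_nodesPW_alongRuns_partialSums` — dag-n24-w1's PartialSums END headline (`…K1EndOfNodes13PWSOfPartialSums.endStatementBPrinted_of_nodesP_alongRuns_partialSums`)
  with `Nodes` asked ONLY under `(leavesP w P).smallCouplings` (the END never read them elsewhere);
  ★★★ `endStatementBPrinted_window_at_recordV_of_nodesW_of_runLetters` (general `N`) — the V-END §1 (`…OfNodesRunLetters.endStatementBPrinted_window_at_recordV_of_nodes_of_runLetters`)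
  with the nodes WINDOW-GUARDED: same `c₀ := 1 − (1+w.β₀)⁻²`, same re-lettering `γ₁ := min (min w.γ γ₀) √(c₀∕(M+1))`, the guarded nodes re-lettered run by run
  (`nodes_leavesP_reletter_of_le`: the window shrinks, so the guard at `γ₁` implies the guard at `w.γ`), the (0.20) leaf from the re-lettered REBOUND twin's S-class, run letters by
  `upper_alongRun_of_runConstRemainder` ∕ `partialSums_alongRun_of_runwisePS`, window by `window_of_frequently_beta_le`.  The V-END §1 is its corollary (guard forgotten) — not restated.
* §2 ★★ `stabilityBV_body_of_rung1VWAt_of_runLetters` — θ∕v-keyed: unity ∧ slots, admissibility, the `RecordSⱽ` text, the GUARDED nodes, the run letters of `β_θ` ⟹ the (B)+window body at `(θ, h, v)`.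
* §3 (N = 2, BY NAME over the tree mirrors `K1V6Defs.Inhabited13`, `K1V9Defs.RecordSV`, `K1V10Defs.…VW`) ★★★ `k1R9BodyAt_of_runRowsContAtSomeRecord13PWSVW` (the route decl's consequent at `F` from
  the LAST LINE-2′ rung at `F`); ★★★ `stabilityBRunRowsAtRecordR13SepCoPHV_byName_of_rowsContWitnessVW`; ★★★ `stabilityBRunRowsAtRecordR13SepCoPHV_of_stubTextsVW` — THE ROUTE DECL
  `Summit.QuantumFields.YangMills.Theses.BalabanUVNodes.StabilityBRunRowsAtRecordR13SepCoPHV` from the THREE REGISTERED LINE-2′ STUB TEXTS by their tree names (= the skeleton's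
  `k1R9_of_stubsVW` ∘ `StabilityBRunRowsAtRecordR13SepCoPHV_proof`).

HONEST FRAMING.  Count-neutral kernel composition; CONDITIONAL on its displayed hypotheses (the nodes, the run letters — [I] Thm 3 p.264 ∕ (5.10), [II] (2.41), §1 pp.263–264 continuity,
unproved in print as theorems of this series —, the stub texts); NO stub of v10 is proved or closed here; K1⁹ ∕ K0⁷ ∕ K3⁸ OPEN; N24 COMPOSITE, N13 NOT discharged; counts unmoved
(typed 28∕28 · discharged 5∕27 · Track A 5∕28).  ONE finite four-torus programme at fixed `ε = L^{−K}`, Bałaban AS PRINTED; route R4 closes the CONDITIONAL finite-𝕋⁴ rung `BalabanLadder.UV`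
only — NOT continuum, NOT ℝ⁴, NOT OS, NOT a mass gap, NOT Clay: the Yang–Mills mass gap is NOT proved by any of this.

Sources (statement shapes only): [Balaban1989LargeFieldII] Thm 1 + (0.1) pp.355–356, p.391; [Balaban1988Convergent] (2.6) p.255, Cor. 3 (2.50) p.264; [Balaban1987RG1] (0.17)–(0.20)
pp.255–256, Thm 2 p.259, (1.20)–(1.22) p.264, Thm 3 p.264, (5.10) p.293, §1 pp.263–264; [Balaban1988RG2Cluster] (2.41) p.21; [Balaban1989LargeFieldI] (1.2) p.178, Prop. 1 p.194.
-/

noncomputable section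

open scoped Matrix.Norms.L2Operator
open Filter Topology

namespace Summit.QuantumFields.YangMills.BalabanUVNodes.K1R9BodyAtRevisedRecordWorldOfNodesWRunLetters

open Literature.MathematicalPhysics.QuantumFieldTheory.Balaban1983to89
open Literature.MathematicalPhysics.QuantumFieldTheory.Balaban1983to89.Node00
open DagBinding T4Continuum T4DatumAssembly FlowStepRuns
open FlowStep (HBeta RGEqH prefixOf)
open Summit.QuantumFields.YangMills.Theorems.BalabanUVNodesK2NamedJetsRunRemAt (RunConstRemainder SurvCont)
open Summit.QuantumFields.YangMills.BalabanUVNodes.K1BetaWindow13SOfNodes13PWSOfBoxH (nodes_leavesP_reletter_of_le isRecordOfRecord₁₃CSepCoPHS_reletter_of_le)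
open Summit.QuantumFields.YangMills.BalabanUVNodes.K1EndOfNodes13PWSOfPartialSums (flowIneq26_of_rg_upper_partialSumsLower)
open Summit.QuantumFields.YangMills.Theorems.BalabanUVNodesK1WindowExactCriterion (window_of_frequently_beta_le)
open Summit.QuantumFields.YangMills.BalabanUVNodes.K1EndOfNodes13PWSOfRunRemAt (upper_alongRun_of_runConstRemainder partialSums_alongRun_of_runwisePS frequently_betaZero_le_of_runConstRemainder)
open Summit.QuantumFields.YangMills.Theorems.K1V6Defs (Inhabited13)
open Summit.QuantumFields.YangMills.Theorems.K1V9Defs (RecordSV)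
open Summit.QuantumFields.YangMills.Theorems.K1V10Defs (NodesAtSomeRecord13PWSVW RunRowsAtSomeRecord13PWSVW RunRowsContAtSomeRecord13PWSVW)

variable {F : T4Family} {N : ℕ} [NeZero N]

/-! ## §1. ★★★ (B) + window AT THE REVISED DATUM from WINDOW-GUARDED nodes at a world bound to it and the run letters -/

section EndVW

/-- **END ALONG RUNS FROM WINDOW-GUARDED NODES** (= `…K1EndOfNodes13PWSOfPartialSums.endStatementBPrinted_of_nodesP_alongRuns_partialSums` with `Nodes (leavesP w P)` asked only under
`(leavesP w P).smallCouplings` — the END road never read them elsewhere: `Dag.UVStability4D ℓ := ℓ.smallCouplings → (ℓ.densitiesDescribed ∧ ℓ.uvBounds)`).  For a dependence-function world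
`w` with `0 < w.γ`: the guarded nodes, the (0.20) leaf, the run-wise ceiling `β_{j+1}(g_j) ≤ w.βup` and the run-wise partial-sum floor along in-interval runs, and the smallness
`M·w.γ² ≤ 1 − (1+w.β₀)⁻²` give `B16.EndStatementBPrinted w.C`.  Kernel bookkeeping; nothing of Bałaban asserted.
[cite: Balaban1989LargeFieldII, Thm 1 p.355 + (0.1) pp.355–356; Balaban1988Convergent, (2.6) p.255 (bookkeeping)] -/
theorem endStatementBPrinted_of_nodesPW_alongRuns_partialSums (w : WorldP) (hγ : 0 < w.γ) {M : ℝ}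
    (hnodes : ∀ P : B12.RunParams, (leavesP w P).smallCouplings → Nodes (leavesP w P))
    (hrg : ∀ P : B12.RunParams, (leavesP w P).smallCouplings → (leavesP w P).rgFlow)
    (hhi : ∀ P : B12.RunParams, (leavesP w P).smallCouplings → ∀ j, j < P.K → (w.C P).flow.β (j + 1) ((w.C P).flow.g j) ≤ w.βup)
    (hps : ∀ P : B12.RunParams, (leavesP w P).smallCouplings → ∀ m n, m ≤ n → n ≤ P.K → -M ≤ ∑ j ∈ Finset.Ico m n, (w.C P).flow.β (j + 1) ((w.C P).flow.g j))
    (hsmall : M * w.γ ^ 2 ≤ 1 - ((1 + w.β₀) ^ 2)⁻¹) : B16.EndStatementBPrinted w.C := by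
  refine endStatementBPrinted_of_worldsP w hγ fun P => fun hsc => ?_
  exact uvStability_of_nodes (leavesP w P) (hnodes P hsc)
    (fun hsc' => flowIneq26_of_rg_upper_partialSumsLower (w.C P).flow P.K w.β₀_pos hsc' (hrg P hsc') (hhi P hsc') (hps P hsc') hsmall) hsc

variable (θ : Stage13HParams F N) (h : θ.Provisos₁₃SepCoPH F N) (v : Revision₁₃ F N θ h) (w : WorldP)

/-- **★★★ THE W-END ROAD: END + WINDOW AT THE REVISED RECORD DATUM `D := datumOfRecord₁₃SepCoPHV θ h v` FROM WINDOW-GUARDED NODES AT A WORLD BOUND TO IT AND THE RUN LETTERS ONLY**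
(general `N`; = the V-END road `…OfNodesRunLetters.endStatementBPrinted_window_at_recordV_of_nodes_of_runLetters` with `hnodes : ∀ P, (leavesP w P).smallCouplings → Nodes (leavesP w P)`;
= the registered «v10» skeleton's kernel glue `endStatementBPrinted_window_of_recordSV_of_nodesW_of_runLetters` at general `N`).  Inputs: the REBOUND twin
`{w with C := (datumOfRecord₁₃SepCoPH θ h).C}` is an S-class record (it supplies the guarded (0.20) leaf, which reads the flow only — identical at the revised datum); `w.C = D.C`; the
thirteen nodes at every IN-WINDOW run of `w`; on SOME level `γ₀ > 0` the run-wise constant remainder of `D.βfun`, `b ≤ B`, the ceiling match `B + r ≤ w.βup`, the run-wise (PS) floor.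
Output: `B16.EndStatementBPrinted D.C` and the `K ≥ 1` window at `D`.  Road: `M ≥ 0` (one-point run); `c₀ := 1 − (1+w.β₀)⁻²`; `γ₁ := min (min w.γ γ₀) √(c₀∕(M+1))`; the guarded nodes
re-lettered run by run (`nodes_leavesP_reletter_of_le`; the guard at `γ₁ ≤ w.γ` implies the guard at `w.γ`); END along runs by the guarded headline above; window from the level-0 β bound.
CONDITIONAL; nothing of Bałaban asserted; no stub closed.
[cite: Balaban1989LargeFieldII, Thm 1 p.355 + (0.1) pp.355–356 + p.391; Balaban1988Convergent, (2.6) p.255, Cor. 3 (2.50) p.264; Balaban1987RG1, (0.17)–(0.20) pp.255–256, Thm 2 p.259, §1 (1.22) p.264, Thm 3 p.264] -/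
theorem endStatementBPrinted_window_at_recordV_of_nodesW_of_runLetters
    (hR₀ : IsRecordOfRecord₁₃CSepCoPHS F N (datumOfRecord₁₃SepCoPH F N θ h) { w with C := (datumOfRecord₁₃SepCoPH F N θ h).C })
    (hC : w.C = (datumOfRecord₁₃SepCoPHV F N θ h v).C) (hnodes : ∀ P : B12.RunParams, (leavesP w P).smallCouplings → Nodes (leavesP w P))
    {b : ℕ → ℝ} {r γ₀ B M : ℝ} (hγ₀ : 0 < γ₀) (hrem : RunConstRemainder (datumOfRecord₁₃SepCoPHV F N θ h v).βfun b r γ₀) (hB : ∀ k, b k ≤ B) (hmatch : B + r ≤ w.βup)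
    (hps : ∀ (n : ℕ) (gs : ℕ → ℝ), RGEqH n (datumOfRecord₁₃SepCoPHV F N θ h v).βfun gs → Step.InInterval γ₀ n gs →
      ∀ k, k ≤ n → -M ≤ ∑ j ∈ Finset.Ico k n, (datumOfRecord₁₃SepCoPHV F N θ h v).βfun j (prefixOf gs j)) :
    B16.EndStatementBPrinted (datumOfRecord₁₃SepCoPHV F N θ h v).C ∧
      ∃ γ₁ : ℝ, 0 < γ₁ ∧ ∀ γ : ℝ, 0 < γ → γ ≤ γ₁ → ∃ P : B12.RunParams, 1 ≤ P.K ∧ ((datumOfRecord₁₃SepCoPHV F N θ h v).C P).flow.InInterval γ P.K := by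
  have hγw : 0 < w.γ := by
    have hγ' := gamma_pos_of_isRecordOfRecord₁₃CSepCoPHS hR₀
    exact hγ'
  -- M ≥ 0 from the empty sum along the one-point run `(γ₀)`
  have hM : 0 ≤ M := by
    have hRG : RGEqH 0 (datumOfRecord₁₃SepCoPHV F N θ h v).βfun (fun _ => γ₀) := fun k hk => absurd hk (Nat.not_lt_zero k)
    have hI : Step.InInterval γ₀ 0 (fun _ => γ₀) := fun _ _ => ⟨hγ₀, le_rfl⟩
    have h0 := hps 0 (fun _ => γ₀) hRG hI 0 le_rfl
    simp only [Finset.Ico_self, Finset.sum_empty] at h0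
    linarith
  -- the smallness constant and the shrunk window
  set c₀ : ℝ := 1 - ((1 + w.β₀) ^ 2)⁻¹ with hc₀_def
  have hc₀ : 0 < c₀ := by
    have h1 : 1 < (1 + w.β₀) ^ 2 := by nlinarith [w.β₀_pos]
    have h2 : ((1 + w.β₀) ^ 2)⁻¹ < 1 := inv_lt_one_of_one_lt₀ h1
    rw [hc₀_def]; linarith
  set γM : ℝ := Real.sqrt (c₀ / (M + 1)) with hγM_def
  have hγM : 0 < γM := Real.sqrt_pos.mpr (by positivity)
  set γ₁ : ℝ := min (min w.γ γ₀) γM with hγ₁_def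
  have hγ₁ : 0 < γ₁ := lt_min (lt_min hγw hγ₀) hγM
  have hγ₁w : γ₁ ≤ w.γ := (min_le_left _ _).trans (min_le_left _ _)
  have hγ₁₀ : γ₁ ≤ γ₀ := (min_le_left _ _).trans (min_le_right _ _)
  have hsmall : M * γ₁ ^ 2 ≤ c₀ := by
    have h1 : γ₁ ^ 2 ≤ γM ^ 2 := pow_le_pow_left₀ hγ₁.le (min_le_right _ _) 2
    have h2 : γM ^ 2 = c₀ / (M + 1) := by rw [hγM_def, Real.sq_sqrt (by positivity)]
    have h3 : M * (c₀ / (M + 1)) ≤ c₀ := by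
      rw [mul_div_assoc']
      rw [div_le_iff₀ (by positivity)]
      nlinarith [hc₀, hM]
    calc M * γ₁ ^ 2 ≤ M * γM ^ 2 := mul_le_mul_of_nonneg_left h1 hM
      _ = M * (c₀ / (M + 1)) := by rw [h2]
      _ ≤ c₀ := h3
  -- the guard at the re-lettered REVISED world from the re-lettered REBOUND twin's S-class (the (0.20) leaf reads the flow only)
  have hR₀' : IsRecordOfRecord₁₃CSepCoPHS F N (datumOfRecord₁₃SepCoPH F N θ h)
      { ({ w with C := (datumOfRecord₁₃SepCoPH F N θ h).C } : WorldP) with γ := γ₁, b := w.b, b_pos := w.b_pos } :=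
    isRecordOfRecord₁₃CSepCoPHS_reletter_of_le hR₀ hγ₁ hγ₁w w.b_pos
  have hguard : ∀ P : B12.RunParams, (leavesP ({ w with γ := γ₁, b := w.b, b_pos := w.b_pos } : WorldP) P).smallCouplings →
      (leavesP ({ w with γ := γ₁, b := w.b, b_pos := w.b_pos } : WorldP) P).rgFlow := by
    intro P hsc
    have hsc' : (leavesP ({ ({ w with C := (datumOfRecord₁₃SepCoPH F N θ h).C } : WorldP) with γ := γ₁, b := w.b, b_pos := w.b_pos } : WorldP) P).smallCouplings := by
      change ((datumOfRecord₁₃SepCoPH F N θ h).C P).flow.InInterval γ₁ P.K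
      change (w.C P).flow.InInterval γ₁ P.K at hsc
      rw [hC] at hsc
      exact hsc
    have h' := rgFlow_of_smallCouplings_of_isRecordOfRecord₁₃CSepCoPHS hR₀' P hsc'
    change ((datumOfRecord₁₃SepCoPH F N θ h).C P).flow.SatisfiesRG P.K at h'
    change (w.C P).flow.SatisfiesRG P.K
    rw [hC]
    exact h'
  -- the guarded nodes at the re-lettered world: the window shrinks, so the guard at `γ₁` gives the guard at `w.γ`
  have hnodes' : ∀ P : B12.RunParams, (leavesP ({ w with γ := γ₁, b := w.b, b_pos := w.b_pos } : WorldP) P).smallCouplings →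
      Nodes (leavesP ({ w with γ := γ₁, b := w.b, b_pos := w.b_pos } : WorldP) P) :=
    fun P hsc => nodes_leavesP_reletter_of_le w hγ₁w w.b_pos P (hnodes P (fun k hk => ⟨(hsc k hk).1, (hsc k hk).2.trans hγ₁w⟩))
  -- the END along runs at the re-lettered revised world, from the GUARDED nodes
  have hEND : B16.EndStatementBPrinted ({ w with γ := γ₁, b := w.b, b_pos := w.b_pos } : WorldP).C := by
    refine endStatementBPrinted_of_nodesPW_alongRuns_partialSums { w with γ := γ₁, b := w.b, b_pos := w.b_pos } hγ₁ (M := M)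
      hnodes' hguard (fun P hsc => ?_) (fun P hsc => ?_) hsmall
    · have hrgP : ((datumOfRecord₁₃SepCoPHV F N θ h v).C.toB12 P).flow.SatisfiesRG P.K := by
        have h' := hguard P hsc
        show ((datumOfRecord₁₃SepCoPHV F N θ h v).C P).flow.SatisfiesRG P.K
        rw [← hC]; exact h'
      have hsc' : ((datumOfRecord₁₃SepCoPHV F N θ h v).C.toB12 P).flow.InInterval γ₁ P.K := by
        show ((datumOfRecord₁₃SepCoPHV F N θ h v).C P).flow.InInterval γ₁ P.K
        rw [← hC]; exact hsc
      show ∀ j, j < P.K → (w.C P).flow.β (j + 1) ((w.C P).flow.g j) ≤ w.βup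
      rw [hC]
      exact fun j hj => (upper_alongRun_of_runConstRemainder (datumOfRecord₁₃SepCoPHV F N θ h v).C.toB12 (datumOfRecord₁₃SepCoPHV F N θ h v).βfun
        (datumOfRecord₁₃SepCoPHV F N θ h v).curries hγ₁₀ hrem hB P hrgP hsc' j hj).trans hmatch
    · have hrgP : ((datumOfRecord₁₃SepCoPHV F N θ h v).C.toB12 P).flow.SatisfiesRG P.K := by
        have h' := hguard P hsc
        show ((datumOfRecord₁₃SepCoPHV F N θ h v).C P).flow.SatisfiesRG P.K
        rw [← hC]; exact h'
      have hsc' : ((datumOfRecord₁₃SepCoPHV F N θ h v).C.toB12 P).flow.InInterval γ₁ P.K := by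
        show ((datumOfRecord₁₃SepCoPHV F N θ h v).C P).flow.InInterval γ₁ P.K
        rw [← hC]; exact hsc
      show ∀ m n, m ≤ n → n ≤ P.K → -M ≤ ∑ j ∈ Finset.Ico m n, (w.C P).flow.β (j + 1) ((w.C P).flow.g j)
      rw [hC]
      exact partialSums_alongRun_of_runwisePS (datumOfRecord₁₃SepCoPHV F N θ h v).C.toB12 (datumOfRecord₁₃SepCoPHV F N θ h v).βfun
        (datumOfRecord₁₃SepCoPHV F N θ h v).curries hγ₁₀ hps P hrgP hsc'
  refine ⟨?_, window_of_frequently_beta_le (datumOfRecord₁₃SepCoPHV F N θ h v) (frequently_betaZero_le_of_runConstRemainder hγ₀ hrem)⟩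
  have : ({ w with γ := γ₁, b := w.b, b_pos := w.b_pos } : WorldP).C = (datumOfRecord₁₃SepCoPHV F N θ h v).C := hC
  rw [← this]
  exact hEND

end EndVW

/-! ## §2. ★★ θ-keyed: the (B)+window BODY OF K1⁹ at the witness `(θ, h, v)` from a `RecordSⱽ` world with WINDOW-GUARDED nodes and the run letters of `β_θ` -/

section BodyVW

/-- **★★ LINE 2′'s CONSEQUENT AT THE WITNESS** (θ∕v-keyed wrapper of the W-END road; = the V-END file's `stabilityBV_body_of_rung1AtV_of_runLetters` with the nodes WINDOW-GUARDED): unity ∧ slots,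
admissibility, the `RecordSⱽ` text (presenting admissible `θ'` of the SAME datum, `w.C = (datumOfRecord₁₃SepCoPHV F N θ h v).C`, window `0 < w.γ ≤ θ'.γ`, `w.L = θ'.L`, S-binding of record),
the thirteen nodes at every IN-WINDOW run, and on SOME level `γ₀ > 0` the run letters for `betaOfRecord₁₃ θ` (= the revised datum's `βfun`, `rfl`) ⟹
`(unity ∧ slots) ∧ Admissible ∧ B16.EndStatementBPrinted (datumOfRecord₁₃SepCoPHV F N θ h v).C ∧` the `K ≥ 1` window.  CONDITIONAL; closes nothing.
[cite: Balaban1989LargeFieldII, Thm 1 p.355 + (0.1) pp.355–356 + p.391; Balaban1988Convergent, (2.6) p.255, Cor. 3 (2.50) p.264; Balaban1987RG1, (0.20) p.256, Thm 2 p.259, Thm 3 p.264 (bookkeeping)] -/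
theorem stabilityBV_body_of_rung1VWAt_of_runLetters (θ : Stage13HParams F N) (h : θ.Provisos₁₃SepCoPH F N) (v : Revision₁₃ F N θ h) (w : WorldP)
    (hU : θ.ZhUnity F N ∧ θ.SlotsNondegenerate₁₃ F N) (hθ : θ.Admissible F N)
    (hRV : ∃ (θ' : Stage13HParams F N) (h' : θ'.Provisos₁₃SepCoPH F N), θ'.Admissible F N ∧
      datumOfRecord₁₃SepCoPH F N θ h = datumOfRecord₁₃SepCoPH F N θ' h' ∧ w.C = (datumOfRecord₁₃SepCoPHV F N θ h v).C ∧ (0 < w.γ ∧ w.γ ≤ θ'.γ) ∧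
      w.L = (θ'.L : ℝ) ∧ ∀ P : B12.RunParams, w.up P = upOfRecord₅CS F N (θ'.toStage5₁₃CoPH F N) P)
    (hnodes : ∀ P : B12.RunParams, (leavesP w P).smallCouplings → Nodes (leavesP w P))
    {b : ℕ → ℝ} {r γ₀ B M : ℝ} (hγ₀ : 0 < γ₀) (hrem : RunConstRemainder (betaOfRecord₁₃ F N θ.toStage13Params) b r γ₀) (hB : ∀ k, b k ≤ B) (hmatch : B + r ≤ w.βup)
    (hps : ∀ (n : ℕ) (gs : ℕ → ℝ), RGEqH n (betaOfRecord₁₃ F N θ.toStage13Params) gs → Step.InInterval γ₀ n gs →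
      ∀ k, k ≤ n → -M ≤ ∑ j ∈ Finset.Ico k n, betaOfRecord₁₃ F N θ.toStage13Params j (prefixOf gs j)) :
    (θ.ZhUnity F N ∧ θ.SlotsNondegenerate₁₃ F N) ∧ θ.Admissible F N ∧ B16.EndStatementBPrinted (datumOfRecord₁₃SepCoPHV F N θ h v).C ∧
      ∃ γ₁ : ℝ, 0 < γ₁ ∧ ∀ γ : ℝ, 0 < γ → γ ≤ γ₁ → ∃ P : B12.RunParams, 1 ≤ P.K ∧ ((datumOfRecord₁₃SepCoPHV F N θ h v).C P).flow.InInterval γ P.K := by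
  obtain ⟨θ', h', hθ', hD, hC, hγ, hL, hup⟩ := hRV
  have hR₀ : IsRecordOfRecord₁₃CSepCoPHS F N (datumOfRecord₁₃SepCoPH F N θ h) { w with C := (datumOfRecord₁₃SepCoPH F N θ h).C } :=
    ⟨θ', h', hθ', hD, rfl, hγ, hL, hup⟩
  exact ⟨hU, hθ, endStatementBPrinted_window_at_recordV_of_nodesW_of_runLetters θ h v w hR₀ hC hnodes hγ₀ hrem hB hmatch hps⟩

end BodyVW

/-! ## §3. ★★★ `N = 2`, BY NAME over the tree mirrors: K1⁹ from the three REGISTERED LINE-2′ stub texts (`K1V10Defs`) -/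

section Line2W

/-- **★★★ THE ROUTE DECL's CONSEQUENT AT `F` FROM THE LAST LINE-2′ RUNG AT `F`** (`K1V10Defs.RunRowsContAtSomeRecord13PWSVW F`, the CONCLUSION of the registered `stub_cont13VW`): the text after
`→` of `Summit.QuantumFields.YangMills.Theses.BalabanUVNodes.StabilityBRunRowsAtRecordR13SepCoPHV` at `F`, VERBATIM — §2 at the rung's witness `(θ, h, v, w)` with its guarded nodes and run
letters; rows (i)(iv)(C) read off the rung.  CONDITIONAL on the rung (a HYPOTHESIS); closes nothing.
[cite: Balaban1989LargeFieldII, Thm 1 + (0.1) pp.355–356; Balaban1987RG1, Thm 3 p.264, (5.10) p.293, §1 pp.263–264 (statement shapes only)] -/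
theorem k1R9BodyAt_of_runRowsContAtSomeRecord13PWSVW (F : T4Family) (hW : RunRowsContAtSomeRecord13PWSVW F) :
    ∃ (θ : Stage13HParams F 2) (h : θ.Provisos₁₃SepCoPH F 2) (v : Revision₁₃ F 2 θ h), (θ.ZhUnity F 2 ∧ θ.SlotsNondegenerate₁₃ F 2) ∧ θ.Admissible F 2 ∧
      B16.EndStatementBPrinted (datumOfRecord₁₃SepCoPHV F 2 θ h v).C ∧
      (∃ γ₁ : ℝ, 0 < γ₁ ∧ ∀ γ : ℝ, 0 < γ → γ ≤ γ₁ → ∃ P : B12.RunParams, 1 ≤ P.K ∧ ((datumOfRecord₁₃SepCoPHV F 2 θ h v).C P).flow.InInterval γ P.K) ∧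
      ∃ (b : ℕ → ℝ) (r γ₀ M : ℝ), 0 < γ₀ ∧
        (∀ (n : ℕ) (gs : ℕ → ℝ), RGEqH n (betaOfRecord₁₃ F 2 θ.toStage13Params) gs → Step.InInterval γ₀ n gs →
          ∀ k, k ≤ n → |betaOfRecord₁₃ F 2 θ.toStage13Params k (prefixOf gs k) - b k| ≤ r) ∧
        (∀ (n : ℕ) (gs : ℕ → ℝ), RGEqH n (betaOfRecord₁₃ F 2 θ.toStage13Params) gs → Step.InInterval γ₀ n gs →
          ∀ k, k ≤ n → -M ≤ ∑ j ∈ Finset.Ico k n, betaOfRecord₁₃ F 2 θ.toStage13Params j (prefixOf gs j)) ∧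
        ∀ k : ℕ, ContinuousOn (fun x : ℝ => betaOfRecord₁₃ F 2 θ.toStage13Params k (FlowStep.clampPrefix (betaOfRecord₁₃ F 2 θ.toStage13Params) γ₀ k x))
          {x : ℝ | 0 < x ∧ x ≤ γ₀ ∧ ∀ j, j ≤ k → 1 / γ₀ ^ 2 ≤ FlowStep.Y (betaOfRecord₁₃ F 2 θ.toStage13Params) γ₀ j x} := by
  obtain ⟨θ, hθP, v, w, hU, hθ, hRV, hnodes, b, r, γ₀, B, M, hγ₀, hrem, hB, hmatch, hps, hsc⟩ := hW
  obtain ⟨hU', hθ', hb, hwin⟩ := stabilityBV_body_of_rung1VWAt_of_runLetters θ hθP v w hU hθ hRV hnodes hγ₀ hrem hB hmatch hps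
  exact ⟨θ, hθP, v, hU', hθ', hb, hwin, b, r, γ₀, M, hγ₀, hrem, hps, hsc⟩

/-- **★★★ THE ROUTE DECL BY NAME FROM «rung 0 ⟹ THE LAST LINE-2′ RUNG» at every `F`** (the ∃→∃ idiom of the registered skeleton: `stub_nodes13PWSVW ∘ stub_runRows13PWSVW ∘ stub_cont13VW` composed
into ONE letter `∀ F, K1V6Defs.Inhabited13 F → K1V10Defs.RunRowsContAtSomeRecord13PWSVW F`) — the theorem above at that witness.  CONDITIONAL (the letter is a HYPOTHESIS); closes NO stub.
[cite: Balaban1989LargeFieldII, Thm 1 + (0.1) pp.355–356; Balaban1987RG1, Thm 3 p.264, §1 pp.263–264 (statement shapes only)] -/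
theorem stabilityBRunRowsAtRecordR13SepCoPHV_byName_of_rowsContWitnessVW (hW : ∀ F : T4Family, Inhabited13 F → RunRowsContAtSomeRecord13PWSVW F) :
    Summit.QuantumFields.YangMills.Theses.BalabanUVNodes.StabilityBRunRowsAtRecordR13SepCoPHV :=
  fun F hinh => k1R9BodyAt_of_runRowsContAtSomeRecord13PWSVW F (hW F hinh)

/-- **★★★ K1⁹ BY NAME FROM THE THREE REGISTERED LINE-2′ STUB TEXTS** — `h₁` = `stub_nodes13PWSVW`'s text (`∀ F, Inhabited13 F → NodesAtSomeRecord13PWSVW F`), `h₂` = `stub_runRows13PWSVW`'s,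
`h₃` = `stub_cont13VW`'s, over the tree mirrors `K1V6Defs.Inhabited13` (v6 l.110–111 verbatim) and `K1V10Defs.…VW` (v10 :452 ∕ :459 ∕ :467 verbatim) — = the registered skeleton's
`k1R9_of_stubsVW` ∕ `StabilityBRunRowsAtRecordR13SepCoPHV_proof` over the tree names.  So three by-name proofs of the registered LINE-2′ texts close the DECIDING crux through this theorem
(or through the sorry-free skeleton).  CONDITIONAL on the three texts; NO stub is proved here; K1⁹ OPEN.
[cite: Balaban1989LargeFieldII, Thm 1 p.355 + (0.1) pp.355–356; Balaban1987RG1, Thm 3 p.264, (5.10) p.293, §1 pp.263–264 (bookkeeping)] -/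
theorem stabilityBRunRowsAtRecordR13SepCoPHV_of_stubTextsVW
    (h₁ : ∀ F : T4Family, Inhabited13 F → NodesAtSomeRecord13PWSVW F)
    (h₂ : ∀ F : T4Family, NodesAtSomeRecord13PWSVW F → RunRowsAtSomeRecord13PWSVW F)
    (h₃ : ∀ F : T4Family, RunRowsAtSomeRecord13PWSVW F → RunRowsContAtSomeRecord13PWSVW F) :
    Summit.QuantumFields.YangMills.Theses.BalabanUVNodes.StabilityBRunRowsAtRecordR13SepCoPHV :=
  stabilityBRunRowsAtRecordR13SepCoPHV_byName_of_rowsContWitnessVW fun F hinh => h₃ F (h₂ F (h₁ F hinh))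

end Line2W

end Summit.QuantumFields.YangMills.BalabanUVNodes.K1R9BodyAtRevisedRecordWorldOfNodesWRunLetters

end
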